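import Mathlib
import Literature.NumberTheory.Transcendental.KZCalculusProofs
import Literature.NumberTheory.Transcendental.SemialgebraicMapsProofs
import Literature.NumberTheory.Transcendental.KZSemialgebraicComplex
import Literature.NumberTheory.Transcendental.KZLogCalculusProofs
import HarnessLib

/-!
# `OffTetraSectorKernel`, line `deform-to-the-oracle`: the fibrewise rescaling `N → A` (stub `stub_yScale`)

Stub `stub_yScale` of the crux `OffTetraSectorKernel` (stmt-KontsevichZagierPeriods-10557, route
HyperbolicBloch), stage 1 of the line `deform-to-the-oracle` (Catalan's square is KZ-equivalent to
the ideal tetrahedron `T(i)`): ONE instance of Kontsevich–Zagier's rule (2). Coordinates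
`x 0 = s`, `x 1 = y`; all planar pieces of the chain carry the integrand
`g(s, y) = 1/((1 + s²) y)`, homogeneous of degree `−1` in `y`. The fibrewise rescaling
`Φ(s, y) = (s, y/(1 − s))` (well defined on `{s < 1}`) is `ℚ`-semialgebraic (coordinates are
quotients of rational polynomials, denominator `1 − s ≠ 0`), injective on `{s < 1}` (inverse
`y′ ↦ y′(1 − s)`), has derivative `[[1, 0], [y/(1 − s)², 1/(1 − s)]]` of determinant
`1/(1 − s) > 0`, and maps `N = {0 < s < 1, 1 − s < y ≤ 1 − s²}` ONTO
`A = {0 < s < 1, 1 < y ≤ 1 + s}` because `(1 − s²)/(1 − s) = 1 + s`. The Jacobian identity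
`g(s, y) = g(s, y/(1 − s)) · 1/(1 − s)` makes `[N] − [A]` ONE element of
`KZ.changeOfVariablesRel ⊆ KZ.relations`, i.e. `KZ.Equivalent N A`, for every pair of
representations `N`, `A` on these domains with integrand `g` (both are GIVEN; no existence is
needed).

References: M. Kontsevich, D. Zagier, *Periods* (2001), §1.2 rule (2); J. Bochnak, M. Coste,
M.-F. Roy, *Real Algebraic Geometry* (1998), §2.2.
-/

noncomputable section

open Set MeasureTheory MvPolynomial
open Literature.NumberTheory.Transcendental Literature.ModelTheory.ExponentialFields

namespace Summit.KontsevichZagierPeriods.HyperbolicBloch.OffTetraSectorKernel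

/-! ## Algebra of the rescaling -/

/-- The coordinates of the fibrewise rescaling `Φ(s, y) = (s, y/(1 − s))`. [folklore] -/
theorem yScale_apply (Φ : (Fin 2 → ℝ) → (Fin 2 → ℝ))
    (hΦ : ∀ v, Φ v = ![v 0, v 1 / (1 - v 0)]) (v : Fin 2 → ℝ) :
    Φ v 0 = v 0 ∧ Φ v 1 = v 1 / (1 - v 0) := by
  rw [hΦ]
  exact ⟨rfl, rfl⟩

/-- **The image of `N` under the rescaling is `A`.** For fixed `s ∈ (0, 1)`, `y ↦ y/(1 − s)` is an
increasing linear bijection with inverse `y′ ↦ y′(1 − s)`, sending `1 − s ↦ 1` and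
`1 − s² ↦ (1 − s²)/(1 − s) = 1 + s`. [folklore] -/
theorem yScale_image (Φ : (Fin 2 → ℝ) → (Fin 2 → ℝ))
    (hΦ : ∀ v, Φ v = ![v 0, v 1 / (1 - v 0)]) :
    Φ '' {x | 0 < x 0 ∧ x 0 < 1 ∧ 1 - x 0 < x 1 ∧ x 1 ≤ 1 - x 0 ^ 2} = {x | 0 < x 0 ∧ x 0 < 1 ∧ 1 < x 1 ∧ x 1 ≤ 1 + x 0} := by
  ext w
  constructor
  · -- `Φ` maps `N` into `A`
    rintro ⟨x, ⟨h0, h1, hL, hU⟩, rfl⟩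
    obtain ⟨e0, e1⟩ := yScale_apply Φ hΦ x
    simp only [mem_setOf_eq, e0, e1]
    have h1' : (0 : ℝ) < 1 - x 0 := by linarith
    refine ⟨h0, h1, (one_lt_div h1').mpr hL, (div_le_iff₀ h1').mpr ?_⟩
    nlinarith [hU]
  · -- `A` is covered: `y = y′(1 − s)`
    rintro ⟨h0, h1, hy1, hyU⟩
    have h1' : (0 : ℝ) < 1 - w 0 := by linarith
    refine ⟨![w 0, w 1 * (1 - w 0)], ?_, ?_⟩
    · simp only [mem_setOf_eq, Matrix.cons_val_zero, Matrix.cons_val_one, Matrix.cons_val_fin_one]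
      refine ⟨h0, h1, (lt_mul_iff_one_lt_left h1').mpr hy1, ?_⟩
      nlinarith [mul_le_mul_of_nonneg_right hyU h1'.le]
    · rw [hΦ]
      funext i
      fin_cases i
      · simp
      · simp only [Fin.mk_one, Fin.isValue, Matrix.cons_val_one, Matrix.cons_val_zero,
          Matrix.cons_val_fin_one]
        field_simp

/-- The rescaling is injective on every `σ ⊆ {s < 1}`: the first coordinate is kept and, for
fixed `s`, the second is linear in `y` with slope `1/(1 − s) ≠ 0`. [folklore] -/
theorem yScale_injOn (Φ : (Fin 2 → ℝ) → (Fin 2 → ℝ))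
    (hΦ : ∀ v, Φ v = ![v 0, v 1 / (1 - v 0)]) {σ : Set (Fin 2 → ℝ)}
    (hσ : σ ⊆ {w | w 0 < 1}) : InjOn Φ σ := by
  intro w hw w' _ h
  have h1 : w 0 < 1 := hσ hw
  obtain ⟨e0, e1⟩ := yScale_apply Φ hΦ w
  obtain ⟨e0', e1'⟩ := yScale_apply Φ hΦ w'
  have hs : w 0 = w' 0 := by rw [← e0, ← e0', h]
  have hv : Φ w 1 = Φ w' 1 := by rw [h]
  rw [e1, e1', ← hs] at hv
  have hk : (1 - w 0) ≠ 0 := (sub_pos.mpr h1).ne'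
  have hu : w 1 = w' 1 := (div_left_inj' hk).mp hv
  funext i
  fin_cases i
  exacts [hs, hu]

/-! ## Semialgebraicity -/

/-- The rescaling is a `ℚ`-semialgebraic map on every `ℚ`-semialgebraic `σ ⊆ {s < 1}`: its
coordinates are the rational polynomial `X₀` and the quotient `X₁ / (1 − X₀)` whose denominator
does not vanish on `σ`. [folklore] -/
theorem yScale_isSemialgebraicMapOn (Φ : (Fin 2 → ℝ) → (Fin 2 → ℝ))
    (hΦ : ∀ v, Φ v = ![v 0, v 1 / (1 - v 0)]) {σ : Set (Fin 2 → ℝ)}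
    (hσ : IsSemialgebraic ℚ σ) (hlt : σ ⊆ {w | w 0 < 1}) : IsSemialgebraicMapOn ℚ σ Φ := by
  have hq0 : ∀ w ∈ σ, aeval w (1 - X 0 : MvPolynomial (Fin 2) ℚ) ≠ 0 := fun w hw => by
    have h1 : w 0 < 1 := hlt hw
    simpa [sub_eq_zero] using h1.ne'
  refine IsSemialgebraicMapOn.of_forall hσ fun j => ?_
  fin_cases j
  · exact (isSemialgebraicFunOn_aeval hσ (X 0)).congr fun w _ => by
      simp [(yScale_apply Φ hΦ w).1]
  · exact (isSemialgebraicFunOn_aeval_div_aeval hσ (X 1) (1 - X 0) hq0).congr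
      fun w _ => by simp [(yScale_apply Φ hΦ w).2]

/-! ## The derivative -/

/-- **The derivative of the rescaling and its determinant.** At a point with `s ≠ 1`, `Φ` has the
Fréchet derivative of matrix `[[1, 0], [y/(1 − s)², 1/(1 − s)]]`, of determinant `1/(1 − s)`.
[folklore] -/
theorem yScale_hasFDerivAt_det (Φ : (Fin 2 → ℝ) → (Fin 2 → ℝ))
    (hΦ : ∀ v, Φ v = ![v 0, v 1 / (1 - v 0)]) {x : Fin 2 → ℝ} (hx : 1 - x 0 ≠ 0) :
    ∃ L : (Fin 2 → ℝ) →L[ℝ] (Fin 2 → ℝ), HasFDerivAt Φ L x ∧ L.det = 1 / (1 - x 0) := by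
  set M : Matrix (Fin 2) (Fin 2) ℝ := !![1, 0; x 1 / (1 - x 0) ^ 2, 1 / (1 - x 0)] with hM
  refine ⟨LinearMap.toContinuousLinearMap (Matrix.toLin' M), ?_, ?_⟩
  · -- derivative, componentwise
    have e0 : HasFDerivAt (fun y : Fin 2 → ℝ => y 0) (ContinuousLinearMap.proj 0) x :=
      hasFDerivAt_apply (𝕜 := ℝ) 0 x
    have e1 : HasFDerivAt (fun y : Fin 2 → ℝ => y 1) (ContinuousLinearMap.proj 1) x :=
      hasFDerivAt_apply (𝕜 := ℝ) 1 x
    have h0 : HasFDerivAt (fun y => Φ y 0)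
        ((ContinuousLinearMap.proj 0).comp (LinearMap.toContinuousLinearMap (Matrix.toLin' M)))
        x := by
      have hf : (fun y => Φ y 0) = fun y : Fin 2 → ℝ => y 0 := by
        funext y
        exact (yScale_apply Φ hΦ y).1
      rw [hf]
      refine e0.congr_fderiv (ContinuousLinearMap.ext fun u => ?_)
      simp [hM, Matrix.toLin'_apply, dotProduct, Fin.sum_univ_two]
    have h1 : HasFDerivAt (fun y => Φ y 1)
        ((ContinuousLinearMap.proj 1).comp (LinearMap.toContinuousLinearMap (Matrix.toLin' M)))
        x := by
      have hf : (fun y => Φ y 1) = fun y : Fin 2 → ℝ =>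
          y 1 * ((fun t : ℝ => t⁻¹) ∘ fun y : Fin 2 → ℝ => 1 - y 0) y := by
        funext y
        rw [(yScale_apply Φ hΦ y).2, div_eq_mul_inv]
        rfl
      rw [hf]
      have hinv := (hasDerivAt_inv hx).comp_hasFDerivAt x (e0.const_sub 1)
      have hcomp := e1.fun_mul hinv
      refine hcomp.congr_fderiv (ContinuousLinearMap.ext fun u => ?_)
      simp [hM, Matrix.toLin'_apply, dotProduct, Fin.sum_univ_two]
      field_simp
    refine hasFDerivAt_pi'' fun i => ?_
    fin_cases i
    exacts [h0, h1]
  · -- determinant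
    rw [LinearMap.det_toContinuousLinearMap, LinearMap.det_toLin', Matrix.det_fin_two]
    simp [hM]

/-- **Rescaling move data on `N`**: a derivative `Φ'` of `Φ` at every point of
`N = {0 < s < 1, 1 − s < y ≤ 1 − s²}` together with the Jacobian identity
`g(s, y) = g(s, y/(1 − s)) · |det Φ'|`, `|det Φ'| = 1/(1 − s)`, for the `y`-homogeneous
integrand `g(s, y) = 1/((1 + s²) y)` (`y > 0` on `N`). [cite: KontsevichZagier2001, §1.2 rule (2)] -/
theorem yScale_moveData (Φ : (Fin 2 → ℝ) → (Fin 2 → ℝ))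
    (hΦ : ∀ v, Φ v = ![v 0, v 1 / (1 - v 0)]) :
    ∃ Φ' : (Fin 2 → ℝ) → ((Fin 2 → ℝ) →L[ℝ] (Fin 2 → ℝ)), ∀ x ∈ {x : Fin 2 → ℝ | 0 < x 0 ∧ x 0 < 1 ∧ 1 - x 0 < x 1 ∧ x 1 ≤ 1 - x 0 ^ 2},
      HasFDerivAt Φ (Φ' x) x ∧
      1 / ((1 + x 0 ^ 2) * x 1) = 1 / ((1 + Φ x 0 ^ 2) * Φ x 1) * |(Φ' x).det| := by
  have hex : ∀ x : Fin 2 → ℝ, ∃ L : (Fin 2 → ℝ) →L[ℝ] (Fin 2 → ℝ),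
      1 - x 0 ≠ 0 → HasFDerivAt Φ L x ∧ L.det = 1 / (1 - x 0) := by
    intro x
    by_cases hx : 1 - x 0 = 0
    · exact ⟨0, fun h => (h hx).elim⟩
    · obtain ⟨L, hL, hdet⟩ := yScale_hasFDerivAt_det Φ hΦ hx
      exact ⟨L, fun _ => ⟨hL, hdet⟩⟩
  choose Φ' hΦ' using hex
  refine ⟨Φ', fun x hx => ?_⟩
  have h1' : (0 : ℝ) < 1 - x 0 := by linarith [hx.2.1]
  have hu : 0 < x 1 := h1'.trans hx.2.2.1
  obtain ⟨hL, hdet⟩ := hΦ' x h1'.ne'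
  refine ⟨hL, ?_⟩
  obtain ⟨e0, e1⟩ := yScale_apply Φ hΦ x
  have h1'' : 1 - x 0 ≠ 0 := h1'.ne'
  have hu' : x 1 ≠ 0 := hu.ne'
  have hQ' : 1 + x 0 ^ 2 ≠ 0 := by positivity
  rw [hdet, e0, e1, abs_of_pos (one_div_pos.mpr h1')]
  field_simp

/-! ## The stub -/

/-- **STUB `stub_yScale`** (Kontsevich–Zagier's rule (2) for the fibrewise rescaling
`Φ(s, y) = (s, y/(1 − s))` of `N = {0 < s < 1, 1 − s < y ≤ 1 − s²}` onto
`A = {0 < s < 1, 1 < y ≤ 1 + s}`). For every pair of representations `N`, `A` on these domains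
with the integrand `g(s, y) = 1/((1 + s²) y)`, `[N] − [A] ∈ changeOfVariablesRel ⊆ relations`
(`Φ` semialgebraic, injective on `{s < 1}`, derivative `[[1, 0], [y/(1 − s)², 1/(1 − s)]]` within
`N` at every point, image `Φ(N) = A` since `(1 − s²)/(1 − s) = 1 + s`, and
`g = (g ∘ Φ) · |det DΦ|` by `y`-homogeneity), i.e. `KZ.Equivalent N A`.
[cite: KontsevichZagier2001, §1.2 rule (2)] -/
theorem stub_yScale : ∀ N A : Literature.NumberTheory.Transcendental.KZ.IntegralRep 2, N.domain = {x | 0 < x 0 ∧ x 0 < 1 ∧ 1 - x 0 < x 1 ∧ x 1 ≤ 1 - x 0 ^ 2} → Set.EqOn N.integrand (fun x => 1 / ((1 + x 0 ^ 2) * x 1)) N.domain → A.domain = {x | 0 < x 0 ∧ x 0 < 1 ∧ 1 < x 1 ∧ x 1 ≤ 1 + x 0} → Set.EqOn A.integrand (fun x => 1 / ((1 + x 0 ^ 2) * x 1)) A.domain → Literature.NumberTheory.Transcendental.KZ.Equivalent N A := by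
  intro N A hN hNi hA hAi
  -- the move `Φ(s, y) = (s, y/(1 − s))`
  obtain ⟨Φ, hΦ⟩ : ∃ Φ : (Fin 2 → ℝ) → (Fin 2 → ℝ), ∀ v, Φ v = ![v 0, v 1 / (1 - v 0)] :=
    ⟨_, fun _ => rfl⟩
  -- `N` lies in the half-plane `s < 1`
  have hsub : N.domain ⊆ {w | w 0 < 1} := fun w hw => by
    rw [hN] at hw
    exact hw.2.1
  -- the image is `A`
  have himage : Φ '' N.domain = {x | 0 < x 0 ∧ x 0 < 1 ∧ 1 < x 1 ∧ x 1 ≤ 1 + x 0} := by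
    rw [hN]
    exact yScale_image Φ hΦ
  -- the four data of the move
  have hΦsa : IsSemialgebraicMapOn ℚ N.domain Φ :=
    yScale_isSemialgebraicMapOn Φ hΦ N.isSemialgebraic_domain hsub
  have hinj : InjOn Φ N.domain := yScale_injOn Φ hΦ hsub
  obtain ⟨Φ', hΦ'⟩ := yScale_moveData Φ hΦ
  have hderiv : ∀ x ∈ N.domain, HasFDerivWithinAt Φ (Φ' x) N.domain x := by
    intro x hx
    have hx' := hx
    rw [hN] at hx'
    exact (hΦ' x hx').1.hasFDerivWithinAt
  -- `[N] − [A]` is one change-of-variables move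
  refine KZ.changeOfVariablesRel_subset_relations
    ⟨2, N, A, Φ, Φ', hΦsa, hderiv, hinj, hA.trans himage.symm, fun x hx => ?_, rfl⟩
  have hx' := hx
  rw [hN] at hx'
  have hΦx : Φ x ∈ A.domain := by
    rw [hA, ← himage]
    exact mem_image_of_mem Φ hx
  rw [hNi hx, hAi hΦx]
  exact (hΦ' x hx').2

end Summit.KontsevichZagierPeriods.HyperbolicBloch.OffTetraSectorKernel

end
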